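import Summits.BirchSwinnertonDyer.BirchSwinnertonDyer.Theorems.EisensteinPrimesLinePhiAtMultiplicativePrime
import Literature.NumberTheory.EllipticCurves.NeronOggShafarevichLocal
import Literature.NumberTheory.EllipticCurves.TateParametrisationTorsion
import HarnessLib

/-!
# Crux 3 `MazurMCOnCellB` (stmt-BirchSwinnertonDyer-19033), line `twistback` v4 — brick (F3′):
# at a MULTIPLICATIVE place `ℓ ≠ p` the characters of a rational `p`-line take the values
# `{φ(ℓ), ψ(ℓ)} = {a_ℓ·ℓ, a_ℓ}` (`a_ℓ = +1` split, `−1` non-split)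

Width seat bsd-line-x2-p1-w7 (g0), self-assigned sequel to brick (F3) (`…LinePsiAtMultiplicativePrime`,
`…LinePhiAtMultiplicativePrime`). HONEST FRAMING (cell `bsd-eis`, run/shared/lean/pub/bsd-eis/): TOOL
THEOREMS ONLY (no `def`, no named fact, no `sorry`); every input is a tree THEOREM (both Tate
uniformisation facts are DISCHARGED in the tree); nothing is booked; no main conjecture / BSD is
proved for any curve; no summit statement is proved; 0 cells / labels / tiers move.

WHY. The KL-flat door of the line (p645525/p645771 and `…KLFlatPartnerUnitsPsi`) carries per pair the
LOCAL BALANCE `1 + Σ_{v∈S₀} δ_{V′}^{(v)} = Σ_{v∈S₀} s_v([φ(v) = v̄] + [ψ(v) = v̄])` over the bad places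
`v ≠ p` of the carrier. The cell reads it on the desk as «`c(E) = 1`» with
`c(E) = Σ_{ℓ ‖ N, ℓ ≠ p, SPLIT} s_ℓ + (additive terms)` (LEAD g9/g10; validated 51/51 on the O9
window): at a multiplicative `ℓ ≠ p` the residual characters are `{φ(ℓ), ψ(ℓ)} = {a_ℓ ℓ, a_ℓ}`
(Tate curve at `ℓ`: `C[p] ≅ μ_p(δ)`, `E[p]/C[p] ≅ 𝔽_p(δ)`, `δ` the unramified sign with
`δ(Frob_ℓ) = a_ℓ`; Greenberg–Vatsal §2 pp. 14–15, p. 27), so a non-split prime nets `0` and a split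
prime nets `s_ℓ` against `δ^{(ℓ)} = s_ℓ d_ℓ`. This file proves the character statement; the sequel
`…LocalBalanceAtMultiplicativePlace` evaluates the door's balance term.

* §1 algebra in `E[p]`: `dvd_of_zsmul_mem_of_not_mem`, `natCast_eq_intCast_of_smul_eq_of_ne_zero`,
  **`lineChars_dichotomy`** (a `σ` acting as `z` on `E[p]/X` with an eigenvector `P₀ ∈ X` of
  eigenvalue `c`, and a `σ`-stable line `Φ₀` with scalars `nφ` on it / `nψ` on its quotient:
  `(nφ, nψ) ∈ {(c, z), (z, c)}`);
* §2 **`exists_mem_tateLine_eigenvector`** — the `bsd-potss` cell's engine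
  (`EtaCartanField.exists_eigenvector_resGalOfEmb_of_uniformizer`, same construction `P₀ = ι⁻¹Ψ(ζ_p)`)
  with the MEMBERSHIP `P₀ ∈ C[p]` recorded: `P₀ ≠ 0`, `P₀` in the Tate line, `res τ • P₀ = (z ℓ) • P₀`;
* §3 **`lineChars_natCast_of_hasSplitMultiplicativeReductionAt`** (`{φ(ℓ), ψ(ℓ)} = {ℓ, 1}`) and
  **`lineChars_natCast_of_not_hasSplitMultiplicativeReductionAtPrime`** (`W` globally minimal, `ℓ`
  odd: `{φ(ℓ), ψ(ℓ)} = {−ℓ, −1}`) for a rational line with characters mod `m, d ∌ ℓ` in the tree's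
  `hφ0`/`hψ0` shapes (no primitivity needed); inputs `TateCurve.Silverman1994_thmV53{_corV54}_tateUniformisation_holds`,
  `GreenbergVatsalTateDatumSign`, `GreenbergVatsalTateFrobeniusSign.frob_apply_sqrt_gamma_ne`,
  `modNCyclotomicCharacter_absGaloisRestrict_frob` (`χ_m(res τ) = χ_d(res τ) = ℓ`).

References: [GreenbergVatsal2000] §2 Prop. (2.4), pp. 14–15, 27; [SilvermanATAEC1994] Ch. V
Thm. 3.1, Lemma 5.2 (c), Thm. 5.3, Cor. 5.4, Ex. 5.11; [SilvermanAEC2009] VII.5 Prop. 5.1 (b);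
[NeukirchANT1999] Ch. I §10 (10.3), Ch. II §9 Prop. (9.6); [Serre1972] §1.11–1.12.
-/

set_option autoImplicit false
set_option linter.dupNamespace false

noncomputable section

open scoped Classical Pointwise

open NumberField IsDedekindDomain Field WeierstrassCurve
  Literature.NumberTheory.EllipticCurves Literature.NumberTheory.GaloisRepresentations
  Literature.NumberTheory.EllipticCurves.GreenbergSelmer
  Literature.NumberTheory.EllipticCurves.Rank1Residual
  Literature.NumberTheory.EllipticCurves.GreenbergVatsal2000
  Summit.BirchSwinnertonDyer.Rank1Residual.X2.GreenbergVatsalTateDatum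
  Summit.BirchSwinnertonDyer.Rank1Residual.X2.GreenbergVatsalTateDatumSign
  Summit.BirchSwinnertonDyer.Rank1Residual.X2.GreenbergVatsalTateDatumCofree
  Summit.BirchSwinnertonDyer.Rank1Residual.X2.GreenbergVatsalTateFrobeniusSign
  Summit.BirchSwinnertonDyer.Rank1Residual.X2
  Summit.BirchSwinnertonDyer.BirchSwinnertonDyer.Theorems.EisensteinPrimesLinePsiAtMultiplicativePrime
  Summit.BirchSwinnertonDyer.BirchSwinnertonDyer.Theorems.EisensteinPrimesLinePhiAtMultiplicativePrime

namespace Summit.BirchSwinnertonDyer.BirchSwinnertonDyer.Theorems.EisensteinPrimesLineCharactersAtMultiplicativePlace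

variable {W : WeierstrassCurve ℚ} [W.IsElliptic] {p : ℕ} [hp : Fact p.Prime]

/-! ## §1. Algebra in `E[p]` -/

omit [W.IsElliptic] in
/-- If `k • P ∈ Φ` for a point `P ∉ Φ` of `E[p]`, then `p ∣ k`. [folklore] -/
theorem dvd_of_zsmul_mem_of_not_mem {Φ : AddSubgroup (geomTorsion W (p : ℤ))}
    {P : geomTorsion W (p : ℤ)} (hP : P ∉ Φ) {k : ℤ} (hk : k • P ∈ Φ) : (p : ℤ) ∣ k := by
  by_contra hndvd
  have hpi : Prime (p : ℤ) := Nat.prime_iff_prime_int.mp hp.out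
  obtain ⟨a, b, hab⟩ := (hpi.irreducible.coprime_iff_not_dvd).mpr hndvd
  have hpP : (p : ℤ) • P = 0 := by
    rw [natCast_zsmul]
    exact AddSubgroup.torsionBy.nsmul P
  apply hP
  have hPeq : P = b • (k • P) := by
    conv_lhs => rw [← one_zsmul P, ← hab]
    rw [add_zsmul, mul_zsmul, mul_zsmul, hpP, zsmul_zero, zero_add]
  rw [hPeq]
  exact Φ.zsmul_mem hk b

omit [W.IsElliptic] in
/-- Two scalars by which one `σ` acts on a NON-ZERO point of `E[p]` agree in `𝔽_p`. [folklore] -/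
theorem natCast_eq_intCast_of_smul_eq_of_ne_zero {P : geomTorsion W (p : ℤ)} (hP0 : P ≠ 0)
    {σ : absoluteGaloisGroup ℚ} {s : ℤ} {n : ℕ} (hs : σ • P = s • P) (hn : σ • P = n • P) :
    (n : ZMod p) = (s : ZMod p) := by
  have hord : addOrderOf P = p := addOrderOf_eq_prime (AddSubgroup.torsionBy.nsmul P) hP0
  have hk : (s - (n : ℤ)) • P = 0 := by
    rw [sub_zsmul, natCast_zsmul, ← hs, ← hn]
    exact sub_self _
  have hdvd : (p : ℤ) ∣ s - (n : ℤ) := by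
    rw [← hord]
    exact (addOrderOf_dvd_iff_zsmul_eq_zero).mpr hk
  have h0 : ((s - (n : ℤ) : ℤ) : ZMod p) = 0 := (ZMod.intCast_zmod_eq_zero_iff_dvd _ p).mpr hdvd
  rw [Int.cast_sub, Int.cast_natCast, sub_eq_zero] at h0
  exact h0.symm

/-- **The dichotomy.** Let `σ ∈ Γ_ℚ` act on `E[p]/X` as the integer `z` (`#X = p`) and have an
eigenvector `P₀ ∈ X`, `P₀ ≠ 0`, `σ • P₀ = c • P₀`; let `Φ₀` be a `σ`-stable line (`#Φ₀ = p`) on which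
`σ` acts as `nφ` and on whose quotient `σ` acts as `nψ`. Then `(nφ, nψ) = (c, z)` (`Φ₀ = X`) or
`(nφ, nψ) = (z, c)` (`Φ₀ ⊓ X = ⊥`) in `𝔽_p`. [folklore] -/
theorem lineChars_dichotomy {Φ₀ X : AddSubgroup (geomTorsion W (p : ℤ))} (hΦ : Nat.card Φ₀ = p)
    (hX : Nat.card X = p) {σ : absoluteGaloisGroup ℚ} (hΦst : ∀ P ∈ Φ₀, σ • P ∈ Φ₀)
    {z : ℤ} (hquot : ∀ Q : geomTorsion W (p : ℤ), σ • Q - z • Q ∈ X)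
    {P₀ : geomTorsion W (p : ℤ)} (hP₀X : P₀ ∈ X) (hP₀0 : P₀ ≠ 0) {c : ℤ} (hP₀ : σ • P₀ = c • P₀)
    {nφ nψ : ℕ} (hφ : ∀ P ∈ Φ₀, σ • P = nφ • P)
    (hψ : ∀ Q : geomTorsion W (p : ℤ), σ • Q - nψ • Q ∈ Φ₀) :
    ((nφ : ZMod p) = (c : ZMod p) ∧ (nψ : ZMod p) = (z : ZMod p)) ∨
      ((nφ : ZMod p) = (z : ZMod p) ∧ (nψ : ZMod p) = (c : ZMod p)) := by
  rcases TateLineDecomposition.inf_eq_bot_or_eq W p hΦ hX with hbot | heq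
  · right
    refine ⟨?_, ?_⟩
    · refine natCast_eq_intCast_of_smul_eq_on_line hΦ (fun P hP ↦ ?_) hφ
      have h1 : σ • P - z • P ∈ (Φ₀ ⊓ X : AddSubgroup _) :=
        ⟨Φ₀.sub_mem (hΦst P hP) (Φ₀.zsmul_mem hP z), hquot P⟩
      rw [hbot, AddSubgroup.mem_bot, sub_eq_zero] at h1
      exact h1
    · have hP₀Φ : P₀ ∉ Φ₀ := fun h ↦ by
        have h1 : P₀ ∈ (Φ₀ ⊓ X : AddSubgroup _) := ⟨h, hP₀X⟩
        rw [hbot, AddSubgroup.mem_bot] at h1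
        exact hP₀0 h1
      have hk : (c - (nψ : ℤ)) • P₀ ∈ Φ₀ := by
        have h := hψ P₀
        rw [hP₀] at h
        rw [sub_zsmul, natCast_zsmul]
        exact h
      have hdvd := dvd_of_zsmul_mem_of_not_mem hP₀Φ hk
      have h0 : ((c - (nψ : ℤ) : ℤ) : ZMod p) = 0 := (ZMod.intCast_zmod_eq_zero_iff_dvd _ p).mpr hdvd
      rw [Int.cast_sub, Int.cast_natCast, sub_eq_zero] at h0
      exact h0.symm
  · left
    subst heq
    exact ⟨natCast_eq_intCast_of_smul_eq_of_ne_zero hP₀0 hP₀ (hφ P₀ hP₀X),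
      natCast_eq_intCast_of_smul_sub_mem hΦ hquot hψ⟩

/-! ## §2. The Tate line at a multiplicative place `v ∤ p` carries an eigenvector of a local
Frobenius with eigenvalue `χ(τ)·ℓ` (engine of the `bsd-potss` cell, with membership recorded) -/

/-- **Eigenvector IN the Tate line.** For a uniformiser `Ψ : ℚ̄_v^× → W(ℚ̄_v)` with kernel `q^ℤ`
(`0 < |q|_v < 1`), equivariant up to sign, a local arithmetic Frobenius `τ` at `𝔐` (place `v`,
`char v = ℓ ≠ p`) with `τ • Ψ(u) = z • Ψ(τ u)`: the point `P₀ = ι⁻¹Ψ(ζ_p)` of `W[p]` is NON-ZERO, lies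
in the Tate line `C ∩ W[p]` (`C = ι⁻¹Ψ(μ)`, the tree's `tateDatum`), and `res τ • P₀ = (z ℓ) • P₀`
(`χ_p(res τ) = ℓ`). Adapted from the `bsd-potss` cell's
`EtaCartanField.exists_eigenvector_resGalOfEmb_of_uniformizer` (same construction; the membership
`P₀ ∈ C[p]` is what this file needs in addition). [cite: SilvermanATAEC1994, Thm. V.3.1 (c),(d), Lemma V.5.2 (c), Thm. V.5.3, Cor. V.5.4 (PDF pp. 395–410)]
[cite: NeukirchANT1999, Ch. I §10 (10.3) and Ch. II §9 Prop. (9.6)] -/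
theorem exists_mem_tateLine_eigenvector {v : HeightOneSpectrum (𝓞 ℚ)} {ℓ : ℕ}
    (hv : (Rat.HeightOneSpectrum.primesEquiv v : ℕ) = ℓ) (hℓp : ℓ ≠ p)
    {𝔐 : Ideal v.localAbsIntegers} (h𝔐 : 𝔐 ∈ v.localPrimesAbove)
    {τ : absoluteGaloisGroup (v.adicCompletion ℚ)}
    (hτ : IsArithFrobAt (v.adicCompletionIntegers ℚ) τ 𝔐)
    {q : v.adicCompletion ℚ} (hq0 : q ≠ 0) (hq1 : Valued.v q < 1)
    {Ψ : Additive (AlgebraicClosure (v.adicCompletion ℚ))ˣ →+ localPoints W (v.adicCompletion ℚ)}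
    (hker : ∀ u : (AlgebraicClosure (v.adicCompletion ℚ))ˣ, Ψ (Additive.ofMul u) = 0 ↔
      ∃ n : ℤ, (u : AlgebraicClosure (v.adicCompletion ℚ)) =
        algebraMap (v.adicCompletion ℚ) (AlgebraicClosure (v.adicCompletion ℚ)) q ^ n)
    (hΦ : ∀ (σ : absoluteGaloisGroup (v.adicCompletion ℚ))
      (u : (AlgebraicClosure (v.adicCompletion ℚ))ˣ),
      σ • Ψ (Additive.ofMul u) = Ψ (Additive.ofMul (Units.map
        (Field.absoluteGaloisGroup.toAlgEquiv (v.adicCompletion ℚ) σ :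
          AlgebraicClosure (v.adicCompletion ℚ) →* AlgebraicClosure (v.adicCompletion ℚ)) u)) ∨
      σ • Ψ (Additive.ofMul u) = -Ψ (Additive.ofMul (Units.map
        (Field.absoluteGaloisGroup.toAlgEquiv (v.adicCompletion ℚ) σ :
          AlgebraicClosure (v.adicCompletion ℚ) →* AlgebraicClosure (v.adicCompletion ℚ)) u)))
    {z : ℤ} (hΨτ : ∀ u : (AlgebraicClosure (v.adicCompletion ℚ))ˣ, τ • Ψ (Additive.ofMul u) =
      z • Ψ (Additive.ofMul (Units.map (Field.absoluteGaloisGroup.toAlgEquiv (v.adicCompletion ℚ) τ :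
        AlgebraicClosure (v.adicCompletion ℚ) →* AlgebraicClosure (v.adicCompletion ℚ)) u))) :
    ∃ P₀ : geomTorsion W (p : ℤ), P₀ ≠ 0 ∧
      P₀ ∈ (tateDatum W p Ψ hΦ).plus.comap
        (AddSubgroup.inclusion (geomTorsion_le_geomPrimaryTorsion W p)) ∧
      absGaloisRestrict ℚ (v.adicCompletion ℚ) τ • P₀ = (z * (ℓ : ℤ)) • P₀ := by
  -- adapted from Theorems/QuadraticBranchSignedControlPlusEtaNonsurjMultiplicativeFrobeniusSign (bsd-potss)
  have hpp := hp.out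
  haveI : CharZero (AlgebraicClosure (v.adicCompletion ℚ)) :=
    charZero_of_injective_algebraMap (algebraMap ℚ (AlgebraicClosure (v.adicCompletion ℚ))).injective
  set ι := closureEmb (K := ℚ) (v.adicCompletion ℚ) with hι
  set σ₁ : absoluteGaloisGroup ℚ := resGalOfEmb ι τ with hσ₁
  have hres : σ₁ = absGaloisRestrict ℚ (v.adicCompletion ℚ) τ := rfl
  -- a global primitive `p`-th root of unity; `σ₁ ζ = ζ^c` with `c ≡ ℓ (mod p)`
  obtain ⟨ζ, hζ⟩ := HasEnoughRootsOfUnity.exists_primitiveRoot (AlgebraicClosure ℚ) p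
  set c : ℕ := ((modNCyclotomicCharacter ℚ p σ₁ : (ZMod p)ˣ) : ZMod p).val with hc
  have hσζ : σ₁ • ζ = ζ ^ c := modNCyclotomicCharacter_spec ℚ p σ₁ ζ hζ.pow_eq_one
  have hcl : (c : ZMod p) = (ℓ : ZMod p) := by
    rw [hc, ZMod.natCast_zmod_val, hres]
    exact modNCyclotomicCharacter_absGaloisRestrict_frob hv h𝔐 hτ p
      (fun h ↦ hℓp (((Nat.prime_dvd_prime_iff_eq (hv ▸ (Rat.HeightOneSpectrum.primesEquiv v).2) hpp).mp
        h)))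
  -- the local root of unity `ζ' = ι ζ` and the action of `τ` on it
  set ζ' : AlgebraicClosure (v.adicCompletion ℚ) := ι ζ with hζ'def
  have hζ' : IsPrimitiveRoot ζ' p := hζ.map_of_injective ι.injective
  have hζ'0 : ζ' ≠ 0 := hζ'.ne_zero hpp.ne_zero
  set ζu : (AlgebraicClosure (v.adicCompletion ℚ))ˣ := Units.mk0 ζ' hζ'0 with hζu
  have hτζ : Field.absoluteGaloisGroup.toAlgEquiv (v.adicCompletion ℚ) τ ζ' = ζ' ^ c := by
    have h := apply_resGalAuxOfEmb_apply ι τ ζ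
    change ι (σ₁ • ζ) = Field.absoluteGaloisGroup.toAlgEquiv (v.adicCompletion ℚ) τ ζ' at h
    rw [← h, hσζ, map_pow]
  have hτζu : Units.map (Field.absoluteGaloisGroup.toAlgEquiv (v.adicCompletion ℚ) τ :
      AlgebraicClosure (v.adicCompletion ℚ) →* AlgebraicClosure (v.adicCompletion ℚ)) ζu = ζu ^ c :=
    Units.ext (by rw [Units.coe_map, MonoidHom.coe_coe, Units.val_pow_eq_pow_val, hζu, Units.val_mk0, hτζ])
  have hζup : ζu ^ p = 1 := Units.ext (by rw [Units.val_pow_eq_pow_val, hζu, Units.val_mk0, hζ'.pow_eq_one,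
    Units.val_one])
  have hζufin : IsOfFinOrder ζu := isOfFinOrder_iff_pow_eq_one.2 ⟨p, hpp.pos, hζup⟩
  set P₁' : localPoints W (v.adicCompletion ℚ) := Ψ (Additive.ofMul ζu) with hP₁'
  have hpP₁' : p • P₁' = 0 := by
    rw [hP₁', ← map_nsmul, ← ofMul_pow, hζup, ofMul_one, map_zero]
  have hP₁'0 : P₁' ≠ 0 := by
    intro h0
    obtain ⟨n, hn⟩ := (hker ζu).mp h0
    have h1 : algebraMap (v.adicCompletion ℚ) (AlgebraicClosure (v.adicCompletion ℚ)) q ^ (n * p) = 1 := by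
      rw [_root_.zpow_mul, zpow_natCast, ← hn, hζu, Units.val_mk0, hζ'.pow_eq_one]
    have h2 : n * (p : ℤ) = 0 := WeierstrassCurve.zpow_algebraMap_eq_one_imp v hq0 hq1 h1
    have hn0 : n = 0 := by
      rcases mul_eq_zero.mp h2 with h | h
      · exact h
      · exact absurd h (by exact_mod_cast hpp.ne_zero)
    rw [hn0, zpow_zero, hζu, Units.val_mk0] at hn
    exact hζ'.ne_one hpp.one_lt hn
  have hτP : τ • P₁' = (z * c) • P₁' := by
    rw [hP₁', hΨτ ζu, hτζu, ofMul_pow, map_nsmul, mul_zsmul, natCast_zsmul]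
  -- globalise along `ι_*`
  obtain ⟨P, hpP, hPP⟩ := exists_pointsMapOfEmb_eq_of_nsmul_eq_zero W ι hpp.ne_zero hpP₁'
  have hPmem : P ∈ geomTorsion W (p : ℤ) := (Submodule.mem_torsionBy_iff _ _).mpr (by
    change (p : ℤ) • P = 0; rw [natCast_zsmul, hpP])
  have hinj : Function.Injective (pointsMapOfEmb W ι) := pointsMapOfEmb_injective W ι
  have hcP : (c : ℤ) • P₁' = (ℓ : ℤ) • P₁' := by
    have hdvd : (p : ℤ) ∣ (ℓ : ℤ) - (c : ℤ) := by
      rw [← ZMod.intCast_eq_intCast_iff_dvd_sub, Int.cast_natCast, Int.cast_natCast]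
      exact hcl
    obtain ⟨k, hk⟩ := hdvd
    have hℓck : (ℓ : ℤ) = c + p * k := by linear_combination hk
    rw [hℓck, add_zsmul, mul_comm, mul_zsmul, natCast_zsmul P₁' p, hpP₁', zsmul_zero, add_zero]
  refine ⟨⟨P, hPmem⟩, fun h0 => hP₁'0 ?_, ?_, Subtype.ext ?_⟩
  · have hP0 : P = 0 := by simpa using congrArg Subtype.val h0
    rw [← hPP, hP0, map_zero]
  · -- membership in the Tate line: `ι P = Ψ(ζu)` with `ζu` of finite order
    rw [TateLineDecomposition.mem_comap_iff, mem_tateDatum_plus_iff]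
    exact ⟨ζu, hζufin, hPP.symm⟩
  · rw [Literature.NumberTheory.EllipticCurves.AddSubgroup.torsionBy.coe_smul, AddSubgroupClass.coe_zsmul]
    change σ₁ • P = (z * (ℓ : ℤ)) • P
    apply hinj
    rw [hσ₁, pointsMapOfEmb_smul, hPP, hτP, map_zsmul, hPP, mul_zsmul, mul_zsmul, hcP]


/-! ## §3. At a multiplicative place `v = (ℓ) ∤ p`: `{φ(ℓ), ψ(ℓ)} = {a_ℓ, a_ℓ·ℓ}` -/

omit hp in
/-- `(primesEquiv v : ℕ)` is the rational prime `natGenerator v` under `v` (definitional). [folklore] -/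
theorem coe_primesEquiv_eq_natGenerator (v : HeightOneSpectrum (𝓞 ℚ)) :
    ((Rat.HeightOneSpectrum.primesEquiv v : Nat.Primes) : ℕ) = Rat.HeightOneSpectrum.natGenerator v :=
  rfl

/-- **SPLIT multiplicative `ℓ ≠ p`: `{φ(ℓ), ψ(ℓ)} = {ℓ, 1}`.** For `W/ℚ` with SPLIT multiplicative
reduction at the place `v = (ℓ)`, `ℓ ≠ p`, a rational line `Φ₀ ≤ W[p]` with characters `φ` mod `m`
(`hφ0` shape) and `ψ` mod `d` (`hψ0` shape), `ℓ ∤ m`, `ℓ ∤ d`: either `φ(ℓ) = ℓ ∧ ψ(ℓ) = 1` (the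
line is the Tate line `C_ℓ[p] ≅ μ_p`) or `φ(ℓ) = 1 ∧ ψ(ℓ) = ℓ` (the line meets it trivially), in
`𝔽_p`. Inputs: the untwisted Tate uniformisation (tree theorem
`TateCurve.Silverman1994_thmV53_tateUniformisation_holds`), the quotient sign
(`GreenbergVatsalTateDatumSign.smul_sub_mem_of_equivariant`), the eigenvector of §2, the
dichotomy of §1, `χ_m(res τ) = χ_d(res τ) = ℓ`. [cite: GreenbergVatsal2000, §2 pp. 14–15 (C ≅ μ, D trivial at a split prime)]
[cite: SilvermanATAEC1994, Thm. V.3.1 (c),(d) and Thm. V.5.3 (a),(b)] [cite: NeukirchANT1999, Ch. I §10 (10.3) and Ch. II §9 Prop. (9.6)] -/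
theorem lineChars_natCast_of_hasSplitMultiplicativeReductionAt {v : HeightOneSpectrum (𝓞 ℚ)} {ℓ : ℕ}
    (hv : (Rat.HeightOneSpectrum.primesEquiv v : ℕ) = ℓ) (hℓp : ℓ ≠ p)
    (hsplit : W.HasSplitMultiplicativeReductionAt v)
    {Φ₀ : AddSubgroup (geomTorsion W (p : ℤ))} (hΦ : IsRationalLine W p Φ₀)
    {m : ℕ} [NeZero m] (φ : DirichletCharacter (ZMod p) m) (hℓm : ¬ ℓ ∣ m)
    {d : ℕ} [NeZero d] (ψ : DirichletCharacter (ZMod p) d) (hℓd : ¬ ℓ ∣ d)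
    (hφ0 : ∀ (σ : absoluteGaloisGroup ℚ), ∀ P ∈ Φ₀,
      σ • P = (φ ((modNCyclotomicCharacter ℚ m σ : (ZMod m)ˣ) : ZMod m)).val • P)
    (hψ0 : ∀ (σ : absoluteGaloisGroup ℚ) (Q : geomTorsion W (p : ℤ)),
      σ • Q - (ψ ((modNCyclotomicCharacter ℚ d σ : (ZMod d)ˣ) : ZMod d)).val • Q ∈ Φ₀) :
    (φ (ℓ : ZMod m) = (ℓ : ZMod p) ∧ ψ (ℓ : ZMod d) = 1) ∨
      (φ (ℓ : ZMod m) = 1 ∧ ψ (ℓ : ZMod d) = (ℓ : ZMod p)) := by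
  have hpp := hp.out
  obtain ⟨𝔐, h𝔐⟩ := v.localPrimesAbove_nonempty
  obtain ⟨τ, hτ⟩ := IsDedekindDomain.HeightOneSpectrum.exists_isArithFrobAt_localAbsIntegers v h𝔐
  obtain ⟨q, Ψ, hq0, hq1, hsurj, hker, hΨσ, -⟩ :=
    TateCurve.Silverman1994_thmV53_tateUniformisation_holds W v hsplit
  have hker' : ∀ u : (AlgebraicClosure (v.adicCompletion ℚ))ˣ, Ψ (Additive.ofMul u) = 0 →
      ∃ a : ℤ, (u : AlgebraicClosure (v.adicCompletion ℚ)) =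
        algebraMap (v.adicCompletion ℚ) (AlgebraicClosure (v.adicCompletion ℚ)) q ^ a :=
    fun u h ↦ (hker u).1 h
  set N := tateDatum W p Ψ (sign_disj W Ψ 0 (sign_of_equivariant W Ψ hΨσ)) with hN
  set X := N.plus.comap (AddSubgroup.inclusion (geomTorsion_le_geomPrimaryTorsion W p)) with hXdef
  have hXcard : Nat.card X = p := by
    rw [hXdef, TateLineDecomposition.natCard_comap_eq W p N, hN]
    exact natCard_tateDatum_plus_inf_torsionBy W p Ψ _ hq0 hq1 hker'
  set σ₁ : absoluteGaloisGroup ℚ := absGaloisRestrict ℚ (v.adicCompletion ℚ) τ with hσ₁def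
  -- the quotient: `σ₁ ≡ 1`
  have hquot : ∀ Q : geomTorsion W (p : ℤ), σ₁ • Q - (1 : ℤ) • Q ∈ X := fun Q ↦
    TateLineDecomposition.smul_sub_zsmul_mem_comap W p N (g := σ₁) (s := 1) (fun m' ↦ by
      rw [one_zsmul]; exact smul_sub_mem_of_equivariant W p Ψ hΨσ hsurj hker' τ m') Q
  -- the eigenvector in the Tate line: `σ₁ • P₀ = ℓ • P₀`
  obtain ⟨P₀, hP₀0, hP₀X, hP₀⟩ := exists_mem_tateLine_eigenvector (W := W) hv hℓp h𝔐 hτ hq0 hq1 hker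
    (sign_disj W Ψ 0 (sign_of_equivariant W Ψ hΨσ)) (z := 1) (fun u ↦ by rw [hΨσ, one_zsmul])
  -- the cyclotomic characters at `σ₁`
  have hχm : ((modNCyclotomicCharacter ℚ m σ₁ : (ZMod m)ˣ) : ZMod m) = (ℓ : ZMod m) :=
    modNCyclotomicCharacter_absGaloisRestrict_frob hv h𝔐 hτ m hℓm
  have hχd : ((modNCyclotomicCharacter ℚ d σ₁ : (ZMod d)ˣ) : ZMod d) = (ℓ : ZMod d) :=
    modNCyclotomicCharacter_absGaloisRestrict_frob hv h𝔐 hτ d hℓd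
  have hφ : ∀ P ∈ Φ₀, σ₁ • P = (φ (ℓ : ZMod m)).val • P := fun P hP ↦ by
    have h := hφ0 σ₁ P hP; rwa [hχm] at h
  have hψ : ∀ Q : geomTorsion W (p : ℤ), σ₁ • Q - (ψ (ℓ : ZMod d)).val • Q ∈ Φ₀ := fun Q ↦ by
    have h := hψ0 σ₁ Q; rwa [hχd] at h
  have key := lineChars_dichotomy hΦ.1 hXcard (fun P hP ↦ hΦ.2 σ₁ P hP) hquot hP₀X hP₀0 hP₀ hφ hψ
  simp only [ZMod.natCast_zmod_val, one_mul, Int.cast_natCast, Int.cast_one] at key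
  exact key

/-- **NON-SPLIT multiplicative odd `ℓ ≠ p`: `{φ(ℓ), ψ(ℓ)} = {−ℓ, −1}`.** For `W/ℚ` globally
minimal with NON-split multiplicative reduction at the odd prime `ℓ ≠ p` (place `v = (ℓ)`), a
rational line `Φ₀ ≤ W[p]` with characters `φ` mod `m ∌ ℓ`, `ψ` mod `d ∌ ℓ`: either
`φ(ℓ) = −ℓ ∧ ψ(ℓ) = −1` or `φ(ℓ) = −1 ∧ ψ(ℓ) = −ℓ` in `𝔽_p` — the unramified quadratic twist of the
split picture: a local arithmetic Frobenius flips `√γ` (`GreenbergVatsalTateFrobeniusSign.frob_apply_sqrt_gamma_ne`),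
so acts as `−1` on the Tate quotient and as `−ℓ` on the Tate line (twisted uniformisation
`TateCurve.Silverman1994_thmV53_corV54_tateUniformisation_holds`). [cite: GreenbergVatsal2000, §2 pp. 14–15]
[cite: SilvermanATAEC1994, Ch. V Lemma 5.2 (c), Thm. 5.3 (a),(b), Cor. 5.4, Ex. 5.11 (b) (held copy PDF pp. 406–410)]
[cite: SilvermanAEC2009, VII.5 Prop. 5.1(b)] [cite: NeukirchANT1999, Ch. I §10 (10.3) and Ch. II §9 Prop. (9.6)] -/
theorem lineChars_natCast_of_not_hasSplitMultiplicativeReductionAtPrime [W.IsGloballyMinimal]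
    {v : HeightOneSpectrum (𝓞 ℚ)} {ℓ : ℕ} [hℓ : Fact ℓ.Prime]
    (hv : (Rat.HeightOneSpectrum.primesEquiv v : ℕ) = ℓ) (hℓp : ℓ ≠ p) (hℓ2 : ℓ ≠ 2)
    (hmult : W.HasMultiplicativeReductionAtPrime ℓ) (hns : ¬ W.HasSplitMultiplicativeReductionAtPrime ℓ)
    {Φ₀ : AddSubgroup (geomTorsion W (p : ℤ))} (hΦ : IsRationalLine W p Φ₀)
    {m : ℕ} [NeZero m] (φ : DirichletCharacter (ZMod p) m) (hℓm : ¬ ℓ ∣ m)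
    {d : ℕ} [NeZero d] (ψ : DirichletCharacter (ZMod p) d) (hℓd : ¬ ℓ ∣ d)
    (hφ0 : ∀ (σ : absoluteGaloisGroup ℚ), ∀ P ∈ Φ₀,
      σ • P = (φ ((modNCyclotomicCharacter ℚ m σ : (ZMod m)ˣ) : ZMod m)).val • P)
    (hψ0 : ∀ (σ : absoluteGaloisGroup ℚ) (Q : geomTorsion W (p : ℤ)),
      σ • Q - (ψ ((modNCyclotomicCharacter ℚ d σ : (ZMod d)ˣ) : ZMod d)).val • Q ∈ Φ₀) :
    (φ (ℓ : ZMod m) = -(ℓ : ZMod p) ∧ ψ (ℓ : ZMod d) = -1) ∨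
      (φ (ℓ : ZMod m) = -1 ∧ ψ (ℓ : ZMod d) = -(ℓ : ZMod p)) := by
  have hpp := hp.out
  have hℓv : ((ℓ : ℕ) : 𝓞 ℚ) ∈ v.asIdeal := natCast_mem_asIdeal_of_primesEquiv_eq hv
  have hmultAt : W.HasMultiplicativeReductionAt v :=
    GreenbergVatsalStrictSelmerMultiplicative.hasMultiplicativeReductionAt_of_mem W ℓ hmult hℓv
  obtain ⟨𝔐, h𝔐⟩ := v.localPrimesAbove_nonempty
  obtain ⟨τ, hτ⟩ := IsDedekindDomain.HeightOneSpectrum.exists_isArithFrobAt_localAbsIntegers v h𝔐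
  obtain ⟨q, t, Ψ, hq0, hq1, ht0, ht2, hsurj, hker, hΨσ, -⟩ :=
    TateCurve.Silverman1994_thmV53_corV54_tateUniformisation_holds W v hmultAt
  have hker' : ∀ u : (AlgebraicClosure (v.adicCompletion ℚ))ˣ, Ψ (Additive.ofMul u) = 0 →
      ∃ a : ℤ, (u : AlgebraicClosure (v.adicCompletion ℚ)) =
        algebraMap (v.adicCompletion ℚ) (AlgebraicClosure (v.adicCompletion ℚ)) q ^ a :=
    fun u h ↦ (hker u).1 h
  have hflip := frob_apply_sqrt_gamma_ne W hℓ2 hmult hns hℓv h𝔐 hτ t ht0 ht2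
  set N := tateDatum W p Ψ (sign_disj W Ψ t hΨσ) with hN
  set X := N.plus.comap (AddSubgroup.inclusion (geomTorsion_le_geomPrimaryTorsion W p)) with hXdef
  have hXcard : Nat.card X = p := by
    rw [hXdef, TateLineDecomposition.natCard_comap_eq W p N, hN]
    exact natCard_tateDatum_plus_inf_torsionBy W p Ψ _ hq0 hq1 hker'
  set σ₁ : absoluteGaloisGroup ℚ := absGaloisRestrict ℚ (v.adicCompletion ℚ) τ with hσ₁def
  -- the quotient: `σ₁ ≡ −1`
  have hquot : ∀ Q : geomTorsion W (p : ℤ), σ₁ • Q - (-1 : ℤ) • Q ∈ X := fun Q ↦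
    TateLineDecomposition.smul_sub_zsmul_mem_comap W p N (g := σ₁) (s := -1) (fun m' ↦ by
      have h := smul_sub_sign_smul_mem W p Ψ t hΨσ hsurj hker' τ m'
      rwa [if_neg hflip] at h) Q
  -- the eigenvector in the Tate line: `σ₁ • P₀ = (−ℓ) • P₀`
  obtain ⟨P₀, hP₀0, hP₀X, hP₀⟩ := exists_mem_tateLine_eigenvector (W := W) hv hℓp h𝔐 hτ hq0 hq1 hker
    (sign_disj W Ψ t hΨσ) (z := -1) (fun u ↦ by rw [hΨσ τ u, if_neg hflip])
  have hχm : ((modNCyclotomicCharacter ℚ m σ₁ : (ZMod m)ˣ) : ZMod m) = (ℓ : ZMod m) :=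
    modNCyclotomicCharacter_absGaloisRestrict_frob hv h𝔐 hτ m hℓm
  have hχd : ((modNCyclotomicCharacter ℚ d σ₁ : (ZMod d)ˣ) : ZMod d) = (ℓ : ZMod d) :=
    modNCyclotomicCharacter_absGaloisRestrict_frob hv h𝔐 hτ d hℓd
  have hφ : ∀ P ∈ Φ₀, σ₁ • P = (φ (ℓ : ZMod m)).val • P := fun P hP ↦ by
    have h := hφ0 σ₁ P hP; rwa [hχm] at h
  have hψ : ∀ Q : geomTorsion W (p : ℤ), σ₁ • Q - (ψ (ℓ : ZMod d)).val • Q ∈ Φ₀ := fun Q ↦ by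
    have h := hψ0 σ₁ Q; rwa [hχd] at h
  have key := lineChars_dichotomy hΦ.1 hXcard (fun P hP ↦ hΦ.2 σ₁ P hP) hquot hP₀X hP₀0 hP₀ hφ hψ
  simp only [ZMod.natCast_zmod_val, neg_one_mul, Int.cast_neg, Int.cast_natCast, Int.cast_one] at key
  exact key


end Summit.BirchSwinnertonDyer.BirchSwinnertonDyer.Theorems.EisensteinPrimesLineCharactersAtMultiplicativePlace

end
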